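import Summits.BirchSwinnertonDyer.Rank1Residual.GaloisImage.KuriharaLowerBoundDeep
import HarnessLib

/-!
# Route `KimAtThreeKolyvagin` (rung W2), crux `DeepUpperAtThree`: the UPPER deep-level ledger —
# `#Sel_{p^K}(E/ℚ) ∣ p^{t+v−ord_p a′}` from the STUB property of the generator at the empty level
# (the Kato-side twin of cell n1011's `DeepLedger.pow_dvd_natCard_selmerGroup_kummer`)

Cell `bsd-addord`, seat `bsd-addord-w2-c3` (D-0074 row B6), item `stmt-BirchSwinnertonDyer-19076`.
Crux 19076 (`ord₃ #Ш(E/ℚ)(3) + ∂^{(∞)}_{deep}(δ̃) ≤ ∂⁽⁰⁾(δ̃)`) has content only on the rows with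
`Ш(E)[3] ≠ 0` (`KimAtThreeDeepUpperShaTrivialRungs`), where it is the UPPER bound on `#Ш[3^∞]` WITH
THE INDEX of Kato's Kolyvagin system in the free rank-one module of Kolyvagin systems (memo
`kim3/KIM3-PROOF.md` §5 Steps 1–5: `length Ш[3^∞] = ord₃(x_1) − j₀`). Cell n1011 (team `b2b-bsdres`)
built the finite-level bookkeeping of that argument for the LOWER bound, at one DEEP level
`K = k + 1`, in WITNESS currency (`GaloisImage/KolyvaginDeepLedger.lean`,
`GaloisImage/KuriharaLowerBoundDeep.lean`): with `Λ` the dictionary functional on `H¹(ℚ_p, E[p^K])`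
(kernel = Kummer condition), `g` the bottom class of a generator of `KS(E[p^K], 𝓕_can, 𝒫)`, Kato's
bottom class `κ′_∅ = a′ • g`, the empty-level dictionary value `Λ(loc κ′_∅) = u · p^t · δ̃₁`,
`δ̃₁ = p^v · (unit)`, Sakamoto's Thm. 4.4 (2) at `∅` in ORDER form and the Poitou–Tate count
`#H¹_{𝓕_can} = p^K · N` (`N = #H¹_{𝓕_can^*}`), they prove `p^{t+v−ord_p a′} ∣ #Sel_{p^K}(E/ℚ)`.

This file proves the converse divisibility — the Kato side — from ONE MORE input, the **STUB
property of the generator at the empty level**: `g = p^{n₀} • e + m` with `e ∈ H¹_{𝓕_can}`,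
`m ∈ Sel_{p^K}(E/ℚ)` and `p^{n₀} = N = #H¹_{𝓕_can^*}` — Rubin 2011 Thm. 2.8.4 / Mazur–Rubin 2004
Thm. 4.3.4 ("`κ_n ∈ p^{λ(n, A^*)} H¹_{𝓕(n)}(ℚ, A)` for every Kolyvagin system when `χ(A) = 1`";
printed under the running hypothesis (H.4) "`Ā ≄ Ā^*` or `p ≥ 5`", which FAILS for `E[3]` — so at
`p = 3` this is a PORT to be discharged from Sakamoto 2024 §7 / the cell memo §3.4, exactly like
n1011's S24-DEEP ports; here it is an explicit hypothesis in witness currency, nothing asserted):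

* `DeepLedgerUpper.natCard_selmerGroup_kummer_dvd_pow_mul` — if SOME `e ∈ H¹_{𝓕_can}` has
  `Λ(loc e) = p^γ · (unit)` then `#Sel_{p^K}(E/ℚ) ∣ p^γ · N` (the image of `Λ ∘ loc` on `H¹_{𝓕_can}`
  is `(p^c)` with `c ≤ γ`, and `#Sel_{p^K} = p^c · N` — n1011's `DeepLedger.natCard_kummer_eq`);
* `DeepLedgerUpper.natCard_selmerGroup_kummer_dvd_pow_of_stub` — with the stub decomposition of
  `g` and `Λ(loc g) = p^β · (unit)`, `β < K`: `#Sel_{p^K}(E/ℚ) ∣ p^β`;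
* **`DeepLedgerUpper.natCard_selmerGroup_kummer_dvd_pow_of_stub_of_kato`** — with Kato's class
  `κ′_∅ = a′ • g`, `a′ = p^α · b`, `p ∤ b`, the dictionary value at `∅` and `t + v < K`:
  `#Sel_{p^K}(E/ℚ) ∣ p^{t+v−α}` — the UPPER BOUND WITH THE INDEX `α = ord_p a′`;
* `DeepLedgerUpper.natCard_selmerGroup_kummer_eq_pow_of_stub_of_kato` — together with n1011's lower
  ledger (order form of Thm. 4.4 (2), the Selmer exponent `X`, deepness `X + t + v ≤ K`):
  `#Sel_{p^K}(E/ℚ) = p^{t+v−α}` — Kim's rank-`0` length formula at one deep finite level, in the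
  tree's own Galois-cohomology currency, general odd `p`.

READING for crux 19076. At a deep core vertex `n` where `Λ_n ∘ loc_p` is injective on `H¹_{𝓕_can(n)}`
the same scalar `a′` gives `ord_p δ̃_n = α − t` (dictionary at `n`), so the upper bound
`ord_p #Sel_{p^K} ≤ t + v − α = v − ord_p δ̃_n` IS the certificate SUPPLY of kim3's
`deepUpperAtThree_of_certificateSupply`; the remaining Kato-side inputs of 19076 in this currency are
therefore exactly: the stub port at `∅`, such core vertices at every depth (Chebotarev; n1011
`PrimeChoice*`), and the dictionary port there (`KatoKuriharaPortThreeAt`). TOOL theorems; no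
definition, no named fact, nothing asserted about any curve.
[cite: Rubin2011, Thm. 2.8.4 and Def. 2.8.1 (p. 24–25), §2.4 (H.4) (p. 20)] [cite: MazurRubin2004, Thm. 4.3.4, Def. 4.3.1]
[cite: Sakamoto2024, Thm. 4.4 (2) (p. 926)] [cite: Kim2022StructureSelmer, Thm. 1.9 (6), Thm. 3.13, Prop. 3.12]
[cite: Kim2025RefinedTNC, Thm 1.1, §5 (5.2)–(5.3)]
-/

set_option autoImplicit false
-- the Theorems namespace of a single-conjunct summit repeats the summit name by design (D-0017)
set_option linter.dupNamespace false

noncomputable section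

open scoped Classical NumberField
open NumberField IsDedekindDomain WeierstrassCurve
  Literature.NumberTheory.EllipticCurves
  Literature.NumberTheory.GaloisRepresentations
  Literature.NumberTheory.GaloisRepresentations.DiscreteGaloisModule Literature.NumberTheory.GaloisCohomology

namespace Summit.BirchSwinnertonDyer.BirchSwinnertonDyer.Theorems.KimAtThreeDeepUpperLedger

open Summit.BirchSwinnertonDyer.Rank1Residual.GaloisImage

namespace DeepLedgerUpper

/-! ## §A Two divisibility facts in `ℤ/p^K` -/

section Algebra

variable {p : ℕ} [hp : Fact p.Prime]

/-- In `ℤ/p^K`: if `p^c ∣ p^γ · w` with `w` a unit and `c ≤ K`, then `c ≤ γ`. [folklore] -/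
theorem le_of_pow_dvd_pow_mul_unit {K c γ : ℕ} (hcK : c ≤ K) (w : (ZMod (p ^ K))ˣ)
    (h : ((p ^ c : ℕ) : ZMod (p ^ K)) ∣ ((p ^ γ : ℕ) : ZMod (p ^ K)) * (w : ZMod (p ^ K))) :
    c ≤ γ := by
  have h' : ((p ^ c : ℕ) : ZMod (p ^ K)) ∣ ((p ^ γ : ℕ) : ZMod (p ^ K)) := by
    have := h.mul_right ((w⁻¹ : (ZMod (p ^ K))ˣ) : ZMod (p ^ K))
    rwa [mul_assoc, Units.mul_inv, mul_one] at this
  rw [Ledger.pow_dvd_natCast_iff hcK] at h'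
  by_contra hlt
  rw [not_le] at hlt
  have h1 : p ^ (γ + 1) ∣ p ^ γ := (Nat.pow_dvd_pow p hlt).trans h'
  have h2 : p ^ γ < p ^ (γ + 1) := Nat.pow_lt_pow_right hp.out.one_lt (by omega)
  exact absurd (Nat.le_of_dvd (pow_pos hp.out.pos γ) h1) (not_le.mpr h2)

/-- In `ℤ/p^K`: if `p^{n₀} · y = p^β · w` with `w` a unit and `β < K`, then `n₀ ≤ β` and
`y = p^{β−n₀} · w′` for a unit `w′` ("`ord_p y = β − n₀`"). [folklore] -/
theorem exists_eq_pow_sub_mul_unit {K n₀ β : ℕ} (hβK : β < K) (y : ZMod (p ^ K))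
    (w : (ZMod (p ^ K))ˣ)
    (h : ((p ^ n₀ : ℕ) : ZMod (p ^ K)) * y = ((p ^ β : ℕ) : ZMod (p ^ K)) * (w : ZMod (p ^ K))) :
    n₀ ≤ β ∧ ∃ w' : (ZMod (p ^ K))ˣ, y = ((p ^ (β - n₀) : ℕ) : ZMod (p ^ K)) * (w' : ZMod (p ^ K)) := by
  have hn : n₀ ≤ β := by
    by_contra hlt
    rw [not_le] at hlt
    -- `p^{β+1} ∣ p^{n₀} y = p^β w`, impossible for `β < K`
    have hdvd : ((p ^ (β + 1) : ℕ) : ZMod (p ^ K)) ∣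
        ((p ^ β : ℕ) : ZMod (p ^ K)) * (w : ZMod (p ^ K)) := by
      rw [← h]
      exact (Nat.cast_dvd_cast (Nat.pow_dvd_pow p hlt)).mul_right y
    have := le_of_pow_dvd_pow_mul_unit (p := p) (by omega) w hdvd
    omega
  refine ⟨hn, ?_⟩
  have h1 : ((p ^ n₀ * 1 : ℕ) : ZMod (p ^ K)) * y =
      ((p ^ β : ℕ) : ZMod (p ^ K)) * (w : ZMod (p ^ K)) := by rw [mul_one]; exact h
  exact Ledger.exists_eq_pow_mul_unit_of_natCast_mul_eq (p := p) hβK hn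
    (by simpa using hp.out.one_lt.ne' ∘ Nat.dvd_one.mp) y w h1

end Algebra

/-! ## §B The upper ledger at one deep level -/

section Main

variable (W : WeierstrassCurve ℚ) [W.IsElliptic] (p : ℕ) [hp : Fact p.Prime] (k : ℕ)

/-- **The upper ledger.** At the level `K = k + 1`, with `Λ` the dictionary functional (kernel
clause `hker`) and the Poitou–Tate count `#H¹_{𝓕_can} = p^K · N`: if SOME class
`e ∈ H¹_{𝓕_can}(ℚ, E[p^K])` has local value `Λ(loc e) = p^γ · (unit)`, then
`#Sel_{p^K}(E/ℚ) ∣ p^γ · N` — the image of `Λ ∘ loc` on `H¹_{𝓕_can}` is `(p^c)` with `c ≤ γ` and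
`#Sel_{p^K} = p^c · N` (n1011's count through `Λ`). [cite: MazurRubin2004, Prop. 2.3.5]
[cite: Kim2022StructureSelmer, Prop. 3.12] -/
theorem natCard_selmerGroup_kummer_dvd_pow_mul (hp2 : p ≠ 2) {v₀ : HeightOneSpectrum (𝓞 ℚ)}
    (hv₀ : ((p : ℕ) : 𝓞 ℚ) ∈ v₀.asIdeal)
    (Λ : galoisCohomology ((W.torsionGaloisModule ((p : ℤ) ^ k * (p : ℤ))).toLocal (Sum.inr v₀)) 1
      →+ ZMod (p ^ (k + 1)))
    (hker : ∀ x ∈ propagatedSelmerStructure W p k (Sum.inr v₀),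
      Λ x = 0 ↔ x ∈ W.kummerSelmerStructure ((p : ℤ) ^ k * (p : ℤ)) (Sum.inr v₀))
    {N : ℕ} (hcount : Nat.card (propagatedSelmerStructure W p k).selmerGroup = p ^ (k + 1) * N)
    {e : galoisCohomology (W.torsionGaloisModule ((p : ℤ) ^ k * (p : ℤ))) 1}
    (he : e ∈ (propagatedSelmerStructure W p k).selmerGroup)
    {γ : ℕ} (w : (ZMod (p ^ (k + 1)))ˣ)
    (heγ : Λ (galoisCohomology.localization _ (Sum.inr v₀) 1 e) =
      ((p ^ γ : ℕ) : ZMod (p ^ (k + 1))) * (w : ZMod (p ^ (k + 1)))) :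
    Nat.card (W.kummerSelmerStructure ((p : ℤ) ^ k * (p : ℤ))).selmerGroup ∣ p ^ γ * N := by
  haveI : NeZero (p ^ (k + 1)) := ⟨pow_ne_zero _ hp.out.ne_zero⟩
  -- `Λ' = Λ ∘ loc ∘ incl : H¹_𝓕 → ℤ/p^{k+1}` (as in n1011's `DeepLedger.natCard_kummer_eq`)
  let Λ' : (propagatedSelmerStructure W p k).selmerGroup →+ ZMod (p ^ (k + 1)) :=
    (Λ.comp (galoisCohomology.localization (W.torsionGaloisModule ((p : ℤ) ^ k * (p : ℤ)))
      (Sum.inr v₀) 1)).comp (propagatedSelmerStructure W p k).selmerGroup.subtype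
  have hΛ'_apply : ∀ x : (propagatedSelmerStructure W p k).selmerGroup,
      Λ' x = Λ (galoisCohomology.localization _ (Sum.inr v₀) 1 (x : galoisCohomology _ 1)) :=
    fun x => rfl
  -- the image is `(p^c)` of order `p^{k+1−c}`, and EVERY image element is divisible by `p^c`
  obtain ⟨c, hcK, -, hdiv, hcardI⟩ := DeepLedger.exists_pow_mem_and_card (p := p) Λ'.range
  -- the kernel is `H¹_𝓚`
  have hkerEq : Λ'.ker = (W.kummerSelmerStructure ((p : ℤ) ^ k * (p : ℤ))).selmerGroup.addSubgroupOf
      (propagatedSelmerStructure W p k).selmerGroup := by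
    ext x
    rw [AddMonoidHom.mem_ker, AddSubgroup.mem_addSubgroupOf, hΛ'_apply]
    exact DeepLedger.apply_localization_eq_zero_iff_mem_kummer W p k hp2 hv₀ Λ hker x.2
  have hkerCard : Nat.card Λ'.ker =
      Nat.card (W.kummerSelmerStructure ((p : ℤ) ^ k * (p : ℤ))).selmerGroup := by
    rw [hkerEq]
    exact Nat.card_congr
      (AddSubgroup.addSubgroupOfEquivOfLe (DeepLedger.selmerGroup_kummer_le W p k)).toEquiv
  -- `#H¹_𝓕 = #ker · #range`, hence `#H¹_𝓚 = p^c · N`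
  have hsplit : Nat.card (propagatedSelmerStructure W p k).selmerGroup =
      Nat.card Λ'.ker * Nat.card Λ'.range := by
    rw [AddSubgroup.card_eq_card_quotient_mul_card_addSubgroup Λ'.ker, mul_comm,
      Nat.card_congr (QuotientAddGroup.quotientKerEquivRange Λ').toEquiv]
  have hcard : Nat.card (W.kummerSelmerStructure ((p : ℤ) ^ k * (p : ℤ))).selmerGroup = p ^ c * N := by
    rw [hkerCard, hcardI, hcount] at hsplit
    have hpow : p ^ (k + 1) = p ^ c * p ^ (k + 1 - c) := by
      rw [← pow_add, Nat.add_sub_cancel' hcK]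
    rw [hpow, mul_assoc, mul_comm (p ^ (k + 1 - c)) N, ← mul_assoc] at hsplit
    exact (Nat.eq_of_mul_eq_mul_right (pow_pos hp.out.pos _) hsplit).symm
  -- `c ≤ γ`: `Λ'(e) = p^γ w` lies in the image
  have hcγ : c ≤ γ := by
    have hmem : Λ' ⟨e, he⟩ ∈ Λ'.range := ⟨⟨e, he⟩, rfl⟩
    have hd := hdiv _ hmem
    rw [hΛ'_apply] at hd
    change ((p ^ c : ℕ) : ZMod (p ^ (k + 1))) ∣
      Λ (galoisCohomology.localization _ (Sum.inr v₀) 1 e) at hd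
    rw [heγ] at hd
    exact le_of_pow_dvd_pow_mul_unit (p := p) hcK w hd
  rw [hcard]
  exact Nat.mul_dvd_mul_right (Nat.pow_dvd_pow p hcγ) N

/-- **The upper ledger from the STUB property of the generator at `∅`.** If the generator's bottom
class decomposes as `g = p^{n₀} • e + m` with `e ∈ H¹_{𝓕_can}`, `m ∈ Sel_{p^K}(E/ℚ)` and
`p^{n₀} = N = #H¹_{𝓕_can^*}` (Rubin 2011 Thm. 2.8.4 / Mazur–Rubin Thm. 4.3.4 at `n = ∅`: the stub
`p^{λ(∅, A^*)} H¹_𝓕`; at `p = 3` a PORT), and `Λ(loc g) = p^β · (unit)` with `β < K`, then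
`#Sel_{p^K}(E/ℚ) ∣ p^β` (since `Λ(loc m) = 0`, `p^{n₀} Λ(loc e) = p^β · unit`, so
`Λ(loc e) = p^{β−n₀} · unit` and the previous theorem applies with `γ = β − n₀`).
[cite: Rubin2011, Thm. 2.8.4 and Def. 2.8.1 (pp. 24–25)] [cite: MazurRubin2004, Thm. 4.3.4] -/
theorem natCard_selmerGroup_kummer_dvd_pow_of_stub (hp2 : p ≠ 2) {v₀ : HeightOneSpectrum (𝓞 ℚ)}
    (hv₀ : ((p : ℕ) : 𝓞 ℚ) ∈ v₀.asIdeal)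
    (Λ : galoisCohomology ((W.torsionGaloisModule ((p : ℤ) ^ k * (p : ℤ))).toLocal (Sum.inr v₀)) 1
      →+ ZMod (p ^ (k + 1)))
    (hker : ∀ x ∈ propagatedSelmerStructure W p k (Sum.inr v₀),
      Λ x = 0 ↔ x ∈ W.kummerSelmerStructure ((p : ℤ) ^ k * (p : ℤ)) (Sum.inr v₀))
    {n₀ : ℕ}
    (hcount : Nat.card (propagatedSelmerStructure W p k).selmerGroup = p ^ (k + 1) * p ^ n₀)
    -- the stub decomposition of the generator's bottom class
    {g e m : galoisCohomology (W.torsionGaloisModule ((p : ℤ) ^ k * (p : ℤ))) 1}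
    (he : e ∈ (propagatedSelmerStructure W p k).selmerGroup)
    (hm : m ∈ (W.kummerSelmerStructure ((p : ℤ) ^ k * (p : ℤ))).selmerGroup)
    (hstub : g = p ^ n₀ • e + m)
    -- the local value of `g`
    {β : ℕ} (hβK : β < k + 1) (w : (ZMod (p ^ (k + 1)))ˣ)
    (hgβ : Λ (galoisCohomology.localization _ (Sum.inr v₀) 1 g) =
      ((p ^ β : ℕ) : ZMod (p ^ (k + 1))) * (w : ZMod (p ^ (k + 1)))) :
    Nat.card (W.kummerSelmerStructure ((p : ℤ) ^ k * (p : ℤ))).selmerGroup ∣ p ^ β := by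
  haveI : NeZero (p ^ (k + 1)) := ⟨pow_ne_zero _ hp.out.ne_zero⟩
  -- `Λ(loc m) = 0`
  have hm0 : Λ (galoisCohomology.localization _ (Sum.inr v₀) 1 m) = 0 :=
    (DeepLedger.apply_localization_eq_zero_iff_mem_kummer W p k hp2 hv₀ Λ hker
      (DeepLedger.selmerGroup_kummer_le W p k hm)).2 hm
  -- `p^{n₀} · Λ(loc e) = p^β · w`
  have hval : ((p ^ n₀ : ℕ) : ZMod (p ^ (k + 1))) * Λ (galoisCohomology.localization _ (Sum.inr v₀) 1 e)
      = ((p ^ β : ℕ) : ZMod (p ^ (k + 1))) * (w : ZMod (p ^ (k + 1))) := by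
    rw [← hgβ, hstub, map_add, map_add, hm0, add_zero, map_nsmul, map_nsmul, nsmul_eq_mul, Nat.cast_pow]
  obtain ⟨hn, w', hw'⟩ := exists_eq_pow_sub_mul_unit (p := p) hβK _ w hval
  have h := natCard_selmerGroup_kummer_dvd_pow_mul W p k hp2 hv₀ Λ hker hcount he (γ := β - n₀)
    w' hw'
  rwa [← pow_add, Nat.sub_add_cancel hn] at h

/-- **THE UPPER BOUND WITH THE INDEX.** Data at the deep level `K = k + 1` as in n1011's
`DeepLedger.pow_dvd_natCard_selmerGroup_of_deep`: the dictionary functional `Λ` (`hker`), Kato's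
bottom class `κ′_∅ = κ_∅` with the empty-level dictionary value `Λ(loc κ_∅) = u · p^t · δ̃₁`,
`δ̃₁ = p^v · (unit)` (`v = ord_p [0]⁺`), `t + v < K`; the generator's bottom class `g` with
`κ′_∅ = a′ • g`, `a′ = p^α · b`, `p ∤ b` (`α = ord_p a′`, the INDEX of Kato's Kolyvagin system in the
free rank-one module); the count `#H¹_{𝓕_can} = p^K · p^{n₀}`; and the STUB decomposition
`g = p^{n₀} • e + m` (`e ∈ H¹_{𝓕_can}`, `m ∈ Sel_{p^K}`). THEN `#Sel_{p^K}(E/ℚ) ∣ p^{t+v−α}`.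
(The lower ledger of n1011 gives `p^{t+v−α} ∣ #Sel_{p^K}` from the order form of Thm. 4.4 (2) and
deepness instead of the stub.) [cite: Kim2022StructureSelmer, Thm. 1.9 (6), Thm. 3.13]
[cite: Rubin2011, Thm. 2.8.4 (p. 25)] [cite: Kato2004Asterisque, Thm. 12.5 (1) (p. 221)] -/
theorem natCard_selmerGroup_kummer_dvd_pow_of_stub_of_kato (hp2 : p ≠ 2)
    {v₀ : HeightOneSpectrum (𝓞 ℚ)} (hv₀ : ((p : ℕ) : 𝓞 ℚ) ∈ v₀.asIdeal)
    (Λ : galoisCohomology ((W.torsionGaloisModule ((p : ℤ) ^ k * (p : ℤ))).toLocal (Sum.inr v₀)) 1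
      →+ ZMod (p ^ (k + 1)))
    (hker : ∀ x ∈ propagatedSelmerStructure W p k (Sum.inr v₀),
      Λ x = 0 ↔ x ∈ W.kummerSelmerStructure ((p : ℤ) ^ k * (p : ℤ)) (Sum.inr v₀))
    -- Kato's classes at the empty level and the dictionary value there
    {κ₀ κ₀' g e m : galoisCohomology (W.torsionGaloisModule ((p : ℤ) ^ k * (p : ℤ))) 1}
    (hbr₀ : κ₀' = κ₀) {t v : ℕ} (htv : t + v < k + 1) (u w₀ : (ZMod (p ^ (k + 1)))ˣ)
    {δ₁ : ZMod (p ^ (k + 1))} (hδ₁ : δ₁ = ((p ^ v : ℕ) : ZMod (p ^ (k + 1))) * (w₀ : ZMod _))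
    (hdict₀ : Λ (galoisCohomology.localization _ (Sum.inr v₀) 1 κ₀) =
      (u : ZMod (p ^ (k + 1))) * (p : ZMod (p ^ (k + 1))) ^ t * δ₁)
    -- Kato's scalar on the generator, with its `p`-adic valuation `α`
    {α b : ℕ} (hb : ¬ p ∣ b) (ha' : κ₀' = (p ^ α * b) • g)
    -- the count and the stub decomposition of the generator's bottom class
    {n₀ : ℕ}
    (hcount : Nat.card (propagatedSelmerStructure W p k).selmerGroup = p ^ (k + 1) * p ^ n₀)
    (he : e ∈ (propagatedSelmerStructure W p k).selmerGroup)
    (hm : m ∈ (W.kummerSelmerStructure ((p : ℤ) ^ k * (p : ℤ))).selmerGroup)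
    (hstub : g = p ^ n₀ • e + m) :
    α ≤ t + v ∧
      Nat.card (W.kummerSelmerStructure ((p : ℤ) ^ k * (p : ℤ))).selmerGroup ∣ p ^ (t + v - α) := by
  haveI : NeZero (p ^ (k + 1)) := ⟨pow_ne_zero _ hp.out.ne_zero⟩
  -- `a′ · Λ(loc g) = p^{t+v} · (u w₀)`
  have hval : ((p ^ α * b : ℕ) : ZMod (p ^ (k + 1))) *
      Λ (galoisCohomology.localization _ (Sum.inr v₀) 1 g) =
      ((p ^ (t + v) : ℕ) : ZMod (p ^ (k + 1))) * ((u * w₀ : (ZMod (p ^ (k + 1)))ˣ) : ZMod _) := by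
    rw [← nsmul_eq_mul, ← map_nsmul, ← map_nsmul, ← ha', hbr₀, hdict₀, hδ₁, Units.val_mul]
    push_cast
    ring
  -- `α ≤ t + v`: otherwise `p^{t+v+1}` would divide `p^{t+v} · unit`
  have hα : α ≤ t + v := by
    by_contra hlt
    rw [not_le] at hlt
    have hdvd : ((p ^ (t + v + 1) : ℕ) : ZMod (p ^ (k + 1))) ∣
        ((p ^ (t + v) : ℕ) : ZMod (p ^ (k + 1))) * ((u * w₀ : (ZMod (p ^ (k + 1)))ˣ) : ZMod _) := by
      rw [← hval]
      refine Dvd.dvd.mul_right ?_ _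
      exact Nat.cast_dvd_cast ((Nat.pow_dvd_pow p hlt).mul_right b)
    have := le_of_pow_dvd_pow_mul_unit (p := p) (by omega) (u * w₀) hdvd
    omega
  refine ⟨hα, ?_⟩
  -- visibility: `Λ(loc g) = p^{t+v−α} · unit`
  obtain ⟨w', hw'⟩ := Ledger.exists_eq_pow_mul_unit_of_natCast_mul_eq (p := p) htv hα hb _ (u * w₀) hval
  exact natCard_selmerGroup_kummer_dvd_pow_of_stub W p k hp2 hv₀ Λ hker hcount he hm hstub
    (β := t + v - α) (by omega) w' hw'

/-- **Kim's rank-`0` length formula at ONE deep finite level, in the tree's Galois-cohomology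
currency: `#Sel_{p^K}(E/ℚ) = p^{t+v−ord_p a′}`.** The upper divisibility is the previous theorem
(stub port); the lower divisibility is n1011's `DeepLedger.pow_dvd_natCard_selmerGroup_kummer`
(order form `hR22` of Sakamoto's Thm. 4.4 (2) at `∅`, the Selmer exponent `p^X`, deepness
`X + t + v ≤ K`). [cite: Kim2022StructureSelmer, Thm. 1.9 (6), Thm. 3.13] [cite: Sakamoto2024, Thm. 4.4 (2) (p. 926)]
[cite: Rubin2011, Thm. 2.8.4 (p. 25)] -/
theorem natCard_selmerGroup_kummer_eq_pow_of_stub_of_kato (hp2 : p ≠ 2)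
    {v₀ : HeightOneSpectrum (𝓞 ℚ)} (hv₀ : ((p : ℕ) : 𝓞 ℚ) ∈ v₀.asIdeal)
    (Λ : galoisCohomology ((W.torsionGaloisModule ((p : ℤ) ^ k * (p : ℤ))).toLocal (Sum.inr v₀)) 1
      →+ ZMod (p ^ (k + 1)))
    (hker : ∀ x ∈ propagatedSelmerStructure W p k (Sum.inr v₀),
      Λ x = 0 ↔ x ∈ W.kummerSelmerStructure ((p : ℤ) ^ k * (p : ℤ)) (Sum.inr v₀))
    {κ₀ κ₀' g e m : galoisCohomology (W.torsionGaloisModule ((p : ℤ) ^ k * (p : ℤ))) 1}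
    (hbr₀ : κ₀' = κ₀) {t v : ℕ} (htv : t + v < k + 1) (u w₀ : (ZMod (p ^ (k + 1)))ˣ)
    {δ₁ : ZMod (p ^ (k + 1))} (hδ₁ : δ₁ = ((p ^ v : ℕ) : ZMod (p ^ (k + 1))) * (w₀ : ZMod _))
    (hdict₀ : Λ (galoisCohomology.localization _ (Sum.inr v₀) 1 κ₀) =
      (u : ZMod (p ^ (k + 1))) * (p : ZMod (p ^ (k + 1))) ^ t * δ₁)
    {α b : ℕ} (hb : ¬ p ∣ b) (ha' : κ₀' = (p ^ α * b) • g)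
    {n₀ : ℕ}
    (hcount : Nat.card (propagatedSelmerStructure W p k).selmerGroup = p ^ (k + 1) * p ^ n₀)
    (hg : g ∈ (propagatedSelmerStructure W p k).selmerGroup)
    (hR22 : (p ^ n₀ ∣ p ^ (k + 1) → addOrderOf g * p ^ n₀ = p ^ (k + 1)) ∧
      (p ^ (k + 1) ∣ p ^ n₀ → g = 0))
    (he : e ∈ (propagatedSelmerStructure W p k).selmerGroup)
    (hm : m ∈ (W.kummerSelmerStructure ((p : ℤ) ^ k * (p : ℤ))).selmerGroup)
    (hstub : g = p ^ n₀ • e + m)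
    {X : ℕ} (hX : ∀ s ∈ (W.kummerSelmerStructure ((p : ℤ) ^ k * (p : ℤ))).selmerGroup, p ^ X • s = 0)
    (hK : X + t + v ≤ k + 1) :
    α ≤ t + v ∧
      Nat.card (W.kummerSelmerStructure ((p : ℤ) ^ k * (p : ℤ))).selmerGroup = p ^ (t + v - α) := by
  haveI : NeZero (p ^ (k + 1)) := ⟨pow_ne_zero _ hp.out.ne_zero⟩
  obtain ⟨hα, hup⟩ := natCard_selmerGroup_kummer_dvd_pow_of_stub_of_kato W p k hp2 hv₀ Λ hker hbr₀ htv
    u w₀ hδ₁ hdict₀ hb ha' hcount he hm hstub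
  refine ⟨hα, Nat.dvd_antisymm hup ?_⟩
  -- the lower divisibility: n1011's deep ledger with `β = t + v − α`
  have hval : ((p ^ α * b : ℕ) : ZMod (p ^ (k + 1))) *
      Λ (galoisCohomology.localization _ (Sum.inr v₀) 1 g) =
      ((p ^ (t + v) : ℕ) : ZMod (p ^ (k + 1))) * ((u * w₀ : (ZMod (p ^ (k + 1)))ˣ) : ZMod _) := by
    rw [← nsmul_eq_mul, ← map_nsmul, ← map_nsmul, ← ha', hbr₀, hdict₀, hδ₁, Units.val_mul]
    push_cast
    ring
  obtain ⟨w', hw'⟩ := Ledger.exists_eq_pow_mul_unit_of_natCast_mul_eq (p := p) htv hα hb _ (u * w₀) hval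
  exact DeepLedger.pow_dvd_natCard_selmerGroup_kummer W p k hp2 hv₀ Λ hker ⟨n₀, rfl⟩ hcount hg hR22
    (β := t + v - α) (by omega) w' hw' hX (by omega)

end Main

end DeepLedgerUpper

end Summit.BirchSwinnertonDyer.BirchSwinnertonDyer.Theorems.KimAtThreeDeepUpperLedger

end
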